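import Literature.Geometry.Kaehler.ComplexTorusCMTypeModelsHodgeClassesDegreeLeSix
import Literature.AlgebraicGeometry.Pohlmann1968.CMFieldDegreeLeSixAllPowersHodgeConjecture
import HarnessLib

/-!
# The models `ℂ^g/Φ(𝔞)` of the NON-primitive CM types of CM fields of degree `≤ 12` (non-simple CM tori of dimension `≤ 6`): the Hodge classes
# of all their powers are generated by divisor classes

Layer `Literature/Geometry/Kaehler`, namespace `Literature.Geometry.Kaehler.ComplexTorus`; lane `lit-hodgefound` (Track 2 foundations library),
prover seat `lit-hodgefound-p10`, generation 33, row «A2-26(hn)» (self-proposed 2026-08-28).  Theorems only; no `def`, no instance, no named fact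
(net Literature debt 0).  Torus-side twin of `Pohlmann1968/CMFieldImprimitiveTypeDegreeLeTwelveHodgeConjecture`; sequel of this generation's
`ComplexTorusCMTypeModelsHodgeClassesDegreeLeSix` (degree `≤ 6`, all types).

`K` a CM field, `[K : ℚ] ≤ 12`, `Φ` NOT primitive, `𝔞` any ideal.  `ℂ^g/Φ(𝔞) ∼ Bⁿ` with `B = ℂ^{g₁}/Φ₁(𝓞_{K₁})` the model of the primitive sub-pair,
`n = [K : K₁] ≥ 2` (the sibling's `two_le_finrank_of_not_isPrimitive`), so `g₁ = [K₁ : ℚ]/2 ≤ 3`; `B` is a simple abelian variety with a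
Mumford–Tate torus, hence `Hdg = Div` on all powers of `B` (`dim ≤ 3`), transported along the isogeny (this generation's
`forall_powPeriod_divisorClasses_eq_hodgeClasses_iff_of_isIsogenous_powPeriod`).

* **`divisorClasses_powPeriod_periodIso_eq_hodgeClasses_of_not_isPrimitive_of_finrank_le_twelve`**,
  **`divisorClasses_powPeriod_periodIso_eq_hodgeClasses_of_not_isSimple_of_finrank_le_twelve`** (`Hdg(Xᵏ) = Div(Xᵏ)` for all `k`, `X = ℂ^g/Φ(𝔞)`
  a NON-SIMPLE model of a CM field of degree `≤ 12`).

## References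

* [MoonenZarhin1999LowDim] B. Moonen, Yu. Zarhin, *Hodge classes on abelian varieties of low dimension*, Math. Ann. 315 (1999), Thm. 0.1, (0.2)(4).
* [Shimura1998] G. Shimura (1998), §6.2 Thm. 3 (pp. 42–44), §8.2 Prop. 26.
* [Streng2010] M. Streng, PhD thesis, Leiden (2010), Ch. I Lemma 3.5.
* [Gordon1999HodgeAVSurvey] B. B. Gordon (1999), 7.6, §9.3.
-/

noncomputable section

open scoped Classical nonZeroDivisors NumberField Manifold ContDiff MatrixGroups
open NumberField Module Polynomial

namespace Literature.Geometry.Kaehler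

namespace ComplexTorus

-- `open scoped`: the tree's action of `Aut(ℂ)` on `Hom(K, ℂ)` by composition (`ringEquivCompAction`) is a scoped instance
open scoped Literature.NumberTheory.ComplexMultiplication
open Literature.NumberTheory.Automorphic (IsTorusSubgroup)
open Literature.AlgebraicGeometry.Motives (CMType HodgeTensorFacts hodgeTensorFacts_holds)
open Literature.NumberTheory.ComplexMultiplication (IsPrimitive inducedCMType exists_primitive_inducedCMType_eq_of_isCMField)
open Literature.NumberTheory.ComplexMultiplication.CMTypeLattice (periodIso basisIndex card_basisIndex_eq_finrank
  isSimple_periodIso_iff_isPrimitive isIsogenous_powPeriod_periodIso_of_basis isAbelianVariety_periodIso)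
open Literature.AlgebraicGeometry.ComplexMultiplication (isPrimitive_ringEquiv_complex_iff)
open Literature.AlgebraicGeometry.Pohlmann1968 (two_le_finrank_of_not_isPrimitive)

variable {K : Type} [Field K] [NumberField K] [IsCMField K]

/-- **`Hdg(Xᵏ) = Div(Xᵏ)` FOR ALL `k`, `X = ℂ^g/Φ(𝔞)` THE MODEL OF A NON-PRIMITIVE CM TYPE OF A CM FIELD OF DEGREE `≤ 12`** (any ideal `𝔞`):
`X ∼ Bⁿ`, `n ≥ 2`, `B` a simple CM abelian variety of dimension `≤ 3` with a Mumford–Tate torus. [cite: MoonenZarhin1999LowDim, Thm. 0.1, (0.2)(4)]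
[cite: Shimura1998, §6.2 Thm. 3, §8.2 Prop. 26] [cite: Streng2010, Ch. I Lemma 3.5] -/
theorem divisorClasses_powPeriod_periodIso_eq_hodgeClasses_of_not_isPrimitive_of_finrank_le_twelve (hK : finrank ℚ K ≤ 12)
    (Φ : CMType K) (φ₀ : K →+* ℂ) (hΦ : ¬ IsPrimitive (ℂ ≃+* ℂ) Φ.1 φ₀) (I : (FractionalIdeal (𝓞 K)⁰ K)ˣ) (k p : ℕ) :
    divisorClasses (powPeriod (periodIso Φ I) k) p = hodgeClasses (powPeriod (periodIso Φ I) k) p := by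
  haveI : HodgeTensorFacts.{0, 0} := hodgeTensorFacts_holds.{0, 0}
  obtain ⟨K₁, Φ₁, hCM, h₁, hp₁, hmin⟩ := exists_primitive_inducedCMType_eq_of_isCMField Φ
  haveI := hCM
  obtain ⟨s₀⟩ : Nonempty (K₁ →+* ℂ) := inferInstance
  have hS : ComplexTorus.IsSimple (periodIso Φ₁ (1 : (FractionalIdeal (𝓞 K₁)⁰ K₁)ˣ)) :=
    (isSimple_periodIso_iff_isPrimitive Φ₁ 1 s₀).2 ((isPrimitive_ringEquiv_complex_iff Φ₁ s₀).2 hp₁)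
  have hY := isAbelianVariety_periodIso Φ₁ (1 : (FractionalIdeal (𝓞 K₁)⁰ K₁)ˣ)
  have h2 : 2 ≤ finrank K₁ K := two_le_finrank_of_not_isPrimitive hmin φ₀ hΦ
  have hmul : finrank ℚ K₁ * finrank K₁ K = finrank ℚ K := Module.finrank_mul_finrank ℚ K₁ K
  have hiso := IsIsogenous.symm _ _ (isIsogenous_powPeriod_periodIso_of_basis h₁ (Module.finBasis K₁ K) I 1)
  have hcard : Fintype.card (basisIndex (1 : (FractionalIdeal (𝓞 K₁)⁰ K₁)ˣ)) ≤ 6 := by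
    rw [card_basisIndex_eq_finrank]
    have h : finrank ℚ K₁ * 2 ≤ finrank ℚ K := hmul ▸ Nat.mul_le_mul_left _ h2
    omega
  haveI : Nonempty (basisIndex (1 : (FractionalIdeal (𝓞 K₁)⁰ K₁)ˣ)) :=
    Fintype.card_pos_iff.1 (by rw [card_basisIndex_eq_finrank]; exact Module.finrank_pos)
  exact (forall_powPeriod_divisorClasses_eq_hodgeClasses_iff_of_isIsogenous_powPeriod hY (by omega) hiso).2
    (fun k p ↦ hY.divisorClasses_powPeriod_eq_hodgeClasses_of_isSimple_of_card_le_six_of_isTorusSubgroup_mumfordTateGroupC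
      hS (isTorusSubgroup_mumfordTateGroupC_periodIso Φ₁ 1) hcard k p) k p

/-- **`Hdg(Xᵏ) = Div(Xᵏ)` FOR ALL `k`, FOR EVERY NON-SIMPLE MODEL `X = ℂ^g/Φ(𝔞)` OF A CM FIELD OF DEGREE `≤ 12`** (non-simple ⟺ `Φ` not primitive).
[cite: MoonenZarhin1999LowDim, Thm. 0.1, (0.2)(4)] [cite: Shimura1998, §6.2 Thm. 3, §8.2 Prop. 26] -/
theorem divisorClasses_powPeriod_periodIso_eq_hodgeClasses_of_not_isSimple_of_finrank_le_twelve (hK : finrank ℚ K ≤ 12)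
    (Φ : CMType K) (I : (FractionalIdeal (𝓞 K)⁰ K)ˣ) (hns : ¬ ComplexTorus.IsSimple (periodIso Φ I)) (k p : ℕ) :
    divisorClasses (powPeriod (periodIso Φ I) k) p = hodgeClasses (powPeriod (periodIso Φ I) k) p := by
  obtain ⟨φ₀⟩ : Nonempty (K →+* ℂ) := inferInstance
  exact divisorClasses_powPeriod_periodIso_eq_hodgeClasses_of_not_isPrimitive_of_finrank_le_twelve hK Φ φ₀
    (fun h ↦ hns ((isSimple_periodIso_iff_isPrimitive Φ I φ₀).2 h)) I k p

end ComplexTorus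

end Literature.Geometry.Kaehler

end
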